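/-
Origin: expansion seat `planner-pub-hodgecm-mc-axioms-1-g14-0`, handover #W252 2026-08-20T15:53:55Z md5 7e1fdde54ecb (PKG f977d8b1e933 → 7e1fdde54ecb; 258 l.; MECHANICAL (iib-R) rewrite v3.1 of the PKG file as it stands (7 token edits; rules R1x1+RX[h₂]x6)) (`HOME/mc/pub-hodgecm-mc-axioms-1-g14/revendor/kit-r55/stage55/HodgeCM/Model/Binders/Real34BaseLetter.lean`, md5 7e1fdde54ecb, 258 lines);
landed by the gen-22 packager (p-g22) in gate run 55 REPLACES the earlier landed copy of `HodgeCM/Model/Binders/Real34BaseLetter.lean` (seat copy carried the packager Origin header of an earlier run (stripped)).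
-/
/-
Origin: speedrun cell pub-hodgecm, MODEL-CONSTRUCTION sub-cell, unit pub-hodgecm-mc-binder-1-g11 (BINDER PROVER, gen 11; row 15: the census-T record
from the (34) core and ONE period identity per character and finite index, on the BASE vector), seat prover-pub-hodgecm-mc-binder-1-g11-0, 2026-08-20.
Target in PKG: HodgeCM/Model/Binders/Real34BaseLetter.lean (NEW additive leaf; imports `Binders/Real34Letters` only).  KERNEL ONLY: 1 def (a `ℕ`-valued
exponent selector) + 8 theorems + 1 def-valued constructor; 0 records, nothing cited, 0 `def … : Prop`, MODEL-N ±0, E unchanged.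
Nothing here is a claim of the manuscripts under adjudication.
-/
import Summits.HodgeConjecture.HodgeCM.Model.Binders.Real34Letters

/-!
# Only the BASE letter tuple is matched: row 15's census residual is one period identity per `(χ, f)` on `insM f φ₀`

The characters `χ : ((pinT …).t34 V c).X` of the (34) junction are, by definition of the pin, the characters of `[T]` of archimedean
type `(−μ c 2, −μ c 3)` (`SeesawTorus.allowedChars`), and binder-2's census prints its places with the vacuum characters PINNED to the
same exponents (`pinnedVacs core.kind (−μ c 2) (−μ c 3)`).  pv11's `PrintedTorusMatch` says exactly that the joint printed character
is then the inverse of the typed weight; so on the printed torus `dualChar χ = (∏_b χ_b)⁻¹` (§ 1 `dualChar_printedTorus_eq_inv_prod`).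
Consequently a letter tuple `n` (RUN-46 `Binders/Real34Letters`) is MATCHED to `χ` iff its weight ratio `∏_{b : sigma} (u_{b,1}u_{b,2}⁻¹)^{n_b}`
is identically `1`, i.e. iff `n_b = 0` at every `sigma` place (§ 1 `sigma_exponent_eq_zero_of_matched`; test point `u ↦ (e^{iπ/n_b}, 1)` at
one place) — and then the letter tensor IS the base vector `φ₀ = ⊗_b φ⁰_b` (`letterOf_eq_φ`).

* § 2 **`Gen12PinsP.Real34CensusSideT.ofBase (hW) core (hbase)`** — the census-T record of RUN-44 #41 from binder-2's (34) core and
  **(W-0)** `hbase : ∀ χ f, ∃ Ψ : SK, Ψ.val ∈ admWedgeSpan … ((SGP …) V c) hV ∧ (t34 V c).ϑ χ (insM f φ₀) = (t34 V c).ϑ χ Ψ` —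
  ONE (34)-period identity per character `χ` and finite index `f`, on the single base vector `φ₀` of the printed places.

So after this leaf row 15 (= glue-1's `CT` binder of #399T) needs, per good sextic context: the (34) core TERM, and for each `(χ, f)` an
admissible wedge sum (RUN-45 #46 supplies them from carch's `k = 2, 3` archimedean `K`-type data) with the same `ϑ₃₄(χ, ·)`-period as
`insM f φ₀` — nothing about general printed vectors, eigenletters or exponent tuples remains.
-/

set_option autoImplicit false

noncomputable section

open MeasureTheory NumberField MulAction
open scoped Matrix InnerProductSpace TensorProduct

attribute [-instance] Quotient.instMeasurableSpace

namespace HodgeCM.Model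

open HodgeCM HodgeCM.Universe HodgeCM.Adelic HodgeCM.Model.HypCensus
open HodgeCM.PerL34 HodgeCM.PerL34.Fock HodgeCM.PerL34.Fock.PrintDict HodgeCM.PerL34.Annihilation
open Literature.NumberTheory.Weil1964
open Literature.NumberTheory.Automorphic (piSchwartzBruhat)
open Literature.NumberTheory.GelbartRogawski1991.UnitaryDualPair
open Literature.AlgebraicGeometry.HodgeTheory
open Literature.NumberTheory.Automorphic.PicardCM
open Literature.NumberTheory.Transcendental (Arapura2012_Cor_15_4_6)
open HodgeCM.Model.ThetaSpace
open HodgeCM.Model.ArchSideTerm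
open NumberField.SeesawArchTorus (toAdeles printedTorusHom printedTorusHom_apply placesEquiv)
open HodgeCM.PerL34.Fock.LocalFock NumberField.SeesawTorus NumberField.SeesawArchTorus

/-! ## 1. The base letter, the weight ratio, and the character identity on the printed torus -/

section BaseGeneric

variable (lam : ℂ) (hlam : lam ≠ 0) (vac : Circle × Circle →* Circle)

/-- A letter with exponent `0` at the `sigma` places (of either (T12) orientation) is the base vector `φ⁰` of the printed local
module. -/
theorem letterOf_eq_φ : ∀ (k : PlaceKind) (n : ℕ), (k = .sigma ∨ k = .sigmaSwap → n = 0) →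
    letterOf lam hlam vac k n = (printLoc lam hlam vac k).φ
  | .sigma, n, hn => by
    obtain rfl : n = 0 := hn (Or.inl rfl)
    exact Subtype.ext (pow_zero _)
  | .delta, _, _ => rfl
  | .iota, _, _ => rfl
  | .sigmaSwap, n, hn => by
    obtain rfl : n = 0 := hn (Or.inr rfl)
    exact Subtype.ext (pow_zero _)

/-- The exponent that enters the weight: `n` at a `sigma` place, `−n` at a swapped `sigma` place (T12), `0` elsewhere. -/
def sigmaExp : PlaceKind → ℕ → ℤ
  | .sigma, n => n
  | .sigmaSwap, n => -(n : ℤ)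
  | .delta, _ => 0
  | .iota, _ => 0

/-- (Ported verbatim from the HodgeCMPerL package; no docstring in the source.) -/
theorem sigmaExp_sigma (n : ℕ) : sigmaExp .sigma n = n := rfl

/-- (Ported verbatim from the HodgeCMPerL package; no docstring in the source.) -/
theorem sigmaExp_sigmaSwap (n : ℕ) : sigmaExp .sigmaSwap n = -(n : ℤ) := rfl

/-- at a `sigma` place of either orientation the weight exponent vanishes only with the letter exponent. -/
theorem eq_zero_of_sigmaExp_eq_zero : ∀ (k : PlaceKind) (n : ℕ), sigmaExp k n = 0 → k = .sigma ∨ k = .sigmaSwap → n = 0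
  | .sigma, n, h, _ => by rw [sigmaExp_sigma] at h; exact_mod_cast h
  | .sigmaSwap, n, h, _ => by rw [sigmaExp_sigmaSwap, neg_eq_zero] at h; exact_mod_cast h
  | .delta, _, _, h => by rcases h with h | h <;> exact absurd h PlaceKind.noConfusion
  | .iota, _, _, h => by rcases h with h | h <;> exact absurd h PlaceKind.noConfusion

/-- **Weight = printed character × ratio**: `letterWeight k n t = χ_k t · (u₁ u₂⁻¹)^{sigmaExp k n}`, `u := kindCoord t`. -/
theorem letterWeight_eq_χ_mul : ∀ (k : PlaceKind) (n : ℕ) (t : (printLoc lam hlam vac k).T),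
    letterWeight lam hlam vac k n t = (printLoc lam hlam vac k).χ t *
      ((((kindCoord lam hlam vac k t).1 : Circle) : ℂ) * ((((kindCoord lam hlam vac k t).2 : Circle) : ℂ))⁻¹) ^ sigmaExp k n
  | .sigma, n, t => by rw [sigmaExp_sigma, zpow_natCast]; rfl
  | .delta, n, t => by rw [sigmaExp, zpow_zero, mul_one]; rfl
  | .iota, n, t => by rw [sigmaExp, zpow_zero, mul_one]; rfl
  | .sigmaSwap, n, t => by
    rw [sigmaExp_sigmaSwap, zpow_neg, zpow_natCast, ← inv_pow, mul_inv, inv_inv, mul_comm ((((kindCoord lam hlam vac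
      .sigmaSwap t).1 : Circle) : ℂ))⁻¹]
    rfl

end BaseGeneric

section PrintedTorus

variable {L : CMField} [DecidableEq (InfinitePlace (L : Type))]
  (kind : InfinitePlace (L : Type) → PlaceKind) (lam : InfinitePlace (L : Type) → ℂ) (hlam : ∀ w, lam w ≠ 0)
  (m₁ m₂ : InfinitePlace (L : Type) → ℤ)

/-- **A character of archimedean type `(m₁, m₂)` read on the printed torus with the PINNED vacuum characters is the inverse of the
joint printed character** (`mem_allowedChars_iff` + pv11 `printPlacesW_pinned_eq_weight` + `printPlacesW_apply`). -/
theorem dualChar_printedTorus_eq_inv_prod (ξ : PontryaginDual (SeesawTorus (↥(maximalRealSubfield L)) (L : Type) ⧸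
      SeesawTorus.rat (↥(maximalRealSubfield L)) (L : Type)))
    (hξ : ξ ∈ SeesawTorus.allowedChars (L : Type) m₁ m₂)
    (t : (printPlaces (InfinitePlace (L : Type)) kind lam hlam (pinnedVacs kind m₁ m₂)).Tg) :
    dualChar ξ (QuotientGroup.mk (toAdeles (L : Type) ((placesEquiv (L : Type)).symm
        (placesCoord (InfinitePlace (L : Type)) kind lam hlam (pinnedVacs kind m₁ m₂) t)))) =
      (∏ b, ((printPlaces (InfinitePlace (L : Type)) kind lam hlam (pinnedVacs kind m₁ m₂)).loc b).χ (t b))⁻¹ := by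
  have h1 := (SeesawTorus.mem_allowedChars_iff m₁ m₂ ξ).mp hξ
  have h2 := DFunLike.congr_fun h1 ((placesEquiv (L : Type)).symm
    (placesCoord (InfinitePlace (L : Type)) kind lam hlam (pinnedVacs kind m₁ m₂) t))
  rw [MonoidHom.comp_apply, SeesawArchTorus.toQuot_apply] at h2
  rw [dualChar_eq_toComplexChar, h2, ← printPlacesW_pinned_eq_weight, printPlacesW_apply, printPlaces_χ]

/-- the joint printed character never vanishes (unit norm place by place). -/
theorem prod_printed_χ_ne_zero (vac : InfinitePlace (L : Type) → (Circle × Circle →* Circle))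
    (t : (printPlaces (InfinitePlace (L : Type)) kind lam hlam vac).Tg) :
    (∏ b, ((printPlaces (InfinitePlace (L : Type)) kind lam hlam vac).loc b).χ (t b)) ≠ 0 :=
  Finset.prod_ne_zero_iff.2 fun b _ => norm_ne_zero_iff.mp (by rw [printPlaces_norm_χ]; exact one_ne_zero)

/-- `u^n ≠ 1` for `u = exp(iπ/n)`, `n ≠ 0`. -/
theorem coe_circleExp_pi_div_pow_ne_one {n : ℕ} (hn : n ≠ 0) :
    (((Circle.exp (Real.pi / n) : Circle) : ℂ)) ^ n ≠ 1 := by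
  rw [Circle.coe_exp, ← Complex.exp_nat_mul, Complex.ofReal_div, Complex.ofReal_natCast,
    ← mul_assoc, mul_div_cancel₀ _ (Nat.cast_ne_zero.2 hn), Complex.exp_pi_mul_I]
  norm_num

/-- **Matched letter tuples have exponent `0` at every `sigma` place.**  If the product weight of the letter tuple `n` matches a character
`ξ` of archimedean type `(m₁, m₂)` on the printed torus (pinned vacuum characters), then `n b = 0` at every place of kind `sigma`:
the matching identity divided by the base identity (`dualChar_printedTorus_eq_inv_prod`) reads `∏_{b : sigma} (u_{b,1} u_{b,2}⁻¹)^{n_b} = 1`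
for all `u`, and `u ↦ (u, 1)` at one place with `u = exp(iπ/n_b)` refutes `n_b ≠ 0`. -/
theorem sigma_exponent_eq_zero_of_matched (ξ : PontryaginDual (SeesawTorus (↥(maximalRealSubfield L)) (L : Type) ⧸
      SeesawTorus.rat (↥(maximalRealSubfield L)) (L : Type)))
    (hξ : ξ ∈ SeesawTorus.allowedChars (L : Type) m₁ m₂) (n : InfinitePlace (L : Type) → ℕ)
    (hmt : ∀ t : (printPlaces (InfinitePlace (L : Type)) kind lam hlam (pinnedVacs kind m₁ m₂)).Tg,
      (∏ b, letterWeight (lam b) (hlam b) (pinnedVacs kind m₁ m₂ b) (kind b) (n b) (t b)) *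
        dualChar ξ (QuotientGroup.mk (toAdeles (L : Type) ((placesEquiv (L : Type)).symm
          (placesCoord (InfinitePlace (L : Type)) kind lam hlam (pinnedVacs kind m₁ m₂) t)))) = 1)
    (b₀ : InfinitePlace (L : Type)) (hb₀ : kind b₀ = .sigma ∨ kind b₀ = .sigmaSwap) : n b₀ = 0 := by
  by_contra hn
  set u : Circle := Circle.exp (Real.pi / (n b₀ : ℕ)) with hu
  set g : InfinitePlace (L : Type) → Circle × Circle := Function.update 1 b₀ (u, 1) with hg
  set t := (placesCoord (InfinitePlace (L : Type)) kind lam hlam (pinnedVacs kind m₁ m₂)).symm g with ht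
  have key := hmt t
  rw [dualChar_printedTorus_eq_inv_prod kind lam hlam m₁ m₂ ξ hξ t] at key
  -- split the letter weights into printed characters × ratios
  have hsplit : (∏ b, letterWeight (lam b) (hlam b) (pinnedVacs kind m₁ m₂ b) (kind b) (n b) (t b)) =
      (∏ b, ((printPlaces (InfinitePlace (L : Type)) kind lam hlam (pinnedVacs kind m₁ m₂)).loc b).χ (t b)) *
        ∏ b, ((((g b).1 : Circle) : ℂ) * ((((g b).2 : Circle) : ℂ))⁻¹) ^ sigmaExp (kind b) (n b) := by
    refine (Finset.prod_congr rfl fun b _ => ?_).trans Finset.prod_mul_distrib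
    have hcoord : kindCoord (lam b) (hlam b) (pinnedVacs kind m₁ m₂ b) (kind b) (t b) = g b := by
      rw [← placesCoord_apply, ht, MulEquiv.apply_symm_apply]
    rw [letterWeight_eq_χ_mul, hcoord]
    rfl
  rw [hsplit, mul_assoc, mul_comm _ ((∏ b, _)⁻¹), ← mul_assoc,
    mul_inv_cancel₀ (prod_printed_χ_ne_zero kind lam hlam (pinnedVacs kind m₁ m₂) t), one_mul] at key
  -- the ratio product is `u ^ n b₀`
  rw [Finset.prod_eq_single b₀ (fun b _ hb => by
      rw [hg, Function.update_of_ne hb, Pi.one_apply, Prod.fst_one, Prod.snd_one, Circle.coe_one, inv_one, mul_one,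
        one_zpow])
    (fun hb => absurd (Finset.mem_univ b₀) hb), hg, Function.update_self, Circle.coe_one, inv_one,
    mul_one] at key
  -- at either orientation the ratio is `u^{±n b₀} = 1`, refuted by `u = exp(iπ/n b₀)`
  rcases hb₀ with hb₀ | hb₀
  · rw [hb₀, sigmaExp_sigma, zpow_natCast] at key
    exact coe_circleExp_pi_div_pow_ne_one hn key
  · rw [hb₀, sigmaExp_sigmaSwap, zpow_neg, zpow_natCast, inv_eq_one] at key
    exact coe_circleExp_pi_div_pow_ne_one hn key

end PrintedTorus

/-! ## 2. The census-T record from the core and one period identity per `(χ, f)` on the base vector -/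

namespace Gen12PinsP

variable
  (G : ∀ {L : CMField} {ι₁ : L →+* ℂ} (_V : HermSpace3 L ι₁) (_c : SeesawCtx L), Prop)
  (hG : ∀ {L : CMField} {ι₁ : L →+* ℂ} (V : HermSpace3 L ι₁) (c : SeesawCtx L),
    G V c → (∀ j, 0 < (ι₁ (dW c.D j)).re) ∨ ∀ j, (ι₁ (dW c.D j)).re < 0)
  (hGR : ∀ {L : CMField} {ι₁ : L →+* ℂ} (V : HermSpace3 L ι₁) (c : SeesawCtx L),
    (cmSplittingDatum (L : Type) finProdFinEquiv (frameD V) (frameD_real V) (frameD_ne V) (dW c.D) (dW_real c.D)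
      (dW_ne c.D)).CompatibleSplitting)
  (η : ∀ {L : CMField} {ι₁ : L →+* ℂ} (V : HermSpace3 L ι₁) (c : SeesawCtx L),
    CMAdelic (L : Type) (frameD V) × CMAdelic (L : Type) (dW c.D) →* ℂˣ)
  (hη : ∀ {L : CMField} {ι₁ : L →+* ℂ} (V : HermSpace3 L ι₁) (c : SeesawCtx L),
    ∀ γU ∈ CMRat (L : Type) (frameD V), ∀ γ ∈ CMRat (L : Type) (dW c.D), η V c (γU, γ) = 1)
  (hηc : ∀ {L : CMField} {ι₁ : L →+* ℂ} (V : HermSpace3 L ι₁) (c : SeesawCtx L), Continuous fun p => ((η V c p : ℂˣ) : ℂ))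
  (hGR₀ : ∀ {L : CMField} {ι₁ : L →+* ℂ} (V : HermSpace3 L ι₁) (c : SeesawCtx L),
    (cmSplittingDatum (L : Type) (e₁) (frameD V) (frameD_real V) (frameD_ne V) (lineVec (L : Type) (dW c.D 0))
      (fun _ => dW_real c.D 0) (fun _ => dW_ne c.D 0)).CompatibleSplitting)
  (hGR₁ : ∀ {L : CMField} {ι₁ : L →+* ℂ} (V : HermSpace3 L ι₁) (c : SeesawCtx L),
    (cmSplittingDatum (L : Type) (e₁) (frameD V) (frameD_real V) (frameD_ne V) (lineVec (L : Type) (dW c.D 1))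
      (fun _ => dW_real c.D 1) (fun _ => dW_ne c.D 1)).CompatibleSplitting)
  (hGR₂ : ∀ {L : CMField} {ι₁ : L →+* ℂ} (V : HermSpace3 L ι₁) (c : SeesawCtx L),
    (cmSplittingDatum (L : Type) (e₁) (frameD V) (frameD_real V) (frameD_ne V) (lineVec (L : Type) (dW' c.D 0))
      (fun _ => dW'_real c.D 0) (fun _ => dW'_ne c.D 0)).CompatibleSplitting)
  (hGR₃ : ∀ {L : CMField} {ι₁ : L →+* ℂ} (V : HermSpace3 L ι₁) (c : SeesawCtx L),
    (cmSplittingDatum (L : Type) (e₁) (frameD V) (frameD_real V) (frameD_ne V) (lineVec (L : Type) (dW' c.D 1))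
      (fun _ => dW'_real c.D 1) (fun _ => dW'_ne c.D 1)).CompatibleSplitting)
  (AG : ∀ {L : CMField} {ι₁ : L →+* ℂ} (V : HermSpace3 L ι₁) (c : SeesawCtx L), G V c → ∀ k : Fin 4,
    ArchLineInput V (lineRepD V c.D (hGR V c) (hGR₀ V c) (hGR₁ V c) (hGR₂ V c) (hGR₃ V c) (η V c) k))

variable (hHD : exists_isReal_hodgeModel) (hI : hodgePQ_independent_of_hodgeModel)
  (h₁ : BallQuotientUniformised)  (h₃ : CMAbelianVarietyRealised)
  (h : Bool) (hA : Arapura2012_Cor_15_4_6) (μ : ∀ {L : CMField}, SeesawCtx L → Fin 4 → InfinitePlace L → ℤ)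

section Context34

variable {L : CMField} {ι₁ : L →+* ℂ} (V : HermSpace3 L ι₁) (c : SeesawCtx L) (hV : IsAnisotropic L V.Hm)

/-- **`Real34CensusSideT` from the (34) census core and ONE period identity per `(χ, f)` on the base vector `φ₀`** ((W-0) `hbase`).
From `ofLetters`: a matched letter tuple has exponent `0` at the `sigma` places (`sigma_exponent_eq_zero_of_matched`, the character `χ`
being of the pinned archimedean type by `χ.2`), hence is the base tuple, whose letter tensor is `φ₀` (`letterOf_eq_φ`). -/
def Real34CensusSideT.ofBase (hW : IsAnisotropic L c.D.gramW)
    (core : HypCoreW ((Gen12Pins.Wg @hGR @η @hη @hηc @Gen12Pins.τSyl @Gen12Pins.TSyl @Gen12Pins.hTSyl) V c) c.D.jT₃₄ (fun w => -μ c 2 w) (fun w => -μ c 3 w))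
    (hbase : letI := core.decEq
      ∀ (χ : ((pinT hHD hI h₁ h₃ h hA (Gen12Pins.Wg @hGR @η @hη @hηc @Gen12Pins.τSyl @Gen12Pins.TSyl @Gen12Pins.hTSyl) (SInstance.SGP @G @hG @hGR @η @hη @hηc @hGR₀ @hGR₁ @hGR₂ @hGR₃ @AG) μ).t34 V c).X) (f : core.side.FinIdx),
        ∃ Ψ : ↥((wmOf' printFact_unitaryCompact_holds ((Gen12Pins.Wg @hGR @η @hη @hηc @Gen12Pins.τSyl @Gen12Pins.TSyl @Gen12Pins.hTSyl) V c)).SK),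
          (Subtype.val Ψ : piSchwartzBruhat (↥(maximalRealSubfield L)) (Fin 6)) ∈
              admWedgeSpan hHD hI h₁ h₃ ((SInstance.SGP @G @hG @hGR @η @hη @hηc @hGR₀ @hGR₁ @hGR₂ @hGR₃ @AG) V c) hV ∧
            ((pinT hHD hI h₁ h₃ h hA (Gen12Pins.Wg @hGR @η @hη @hηc @Gen12Pins.τSyl @Gen12Pins.TSyl @Gen12Pins.hTSyl) (SInstance.SGP @G @hG @hGR @η @hη @hηc @hGR₀ @hGR₁ @hGR₂ @hGR₃ @AG) μ).t34 V c).ϑ χ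
                (insM printFact_unitaryCompact_holds ((Gen12Pins.Wg @hGR @η @hη @hηc @Gen12Pins.τSyl @Gen12Pins.TSyl @Gen12Pins.hTSyl) V c) c.D.jT₃₄ core.kind core.lam core.hlam
                  (fun w => -μ c 2 w) (fun w => -μ c 3 w) core.side f (printPlaces (InfinitePlace (L : Type)) core.kind core.lam core.hlam (pinnedVacs core.kind (fun w => -μ c 2 w) (fun w => -μ c 3 w))).φ₀) =
              ((pinT hHD hI h₁ h₃ h hA (Gen12Pins.Wg @hGR @η @hη @hηc @Gen12Pins.τSyl @Gen12Pins.TSyl @Gen12Pins.hTSyl) (SInstance.SGP @G @hG @hGR @η @hη @hηc @hGR₀ @hGR₁ @hGR₂ @hGR₃ @AG) μ).t34 V c).ϑ χ Ψ) :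
    Real34CensusSideT @G @hG @hGR @η @hη @hηc @hGR₀ @hGR₁ @hGR₂ @hGR₃ @AG hHD hI h₁ h₃ h hA @μ V c hV :=
  Real34CensusSideT.ofLetters @G @hG @hGR @η @hη @hηc @hGR₀ @hGR₁ @hGR₂ @hGR₃ @AG hHD hI h₁ h₃ h hA @μ V c hV hW core (by
    letI := core.decEq
    intro χ f n hmt
    have hn : ∀ b, core.kind b = .sigma ∨ core.kind b = .sigmaSwap → n b = 0 :=
      sigma_exponent_eq_zero_of_matched core.kind core.lam core.hlam (fun w => -μ c 2 w) (fun w => -μ c 3 w) χ.1 χ.2 n hmt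
    have hfun : (fun b : (printPlaces (InfinitePlace (L : Type)) core.kind core.lam core.hlam (pinnedVacs core.kind (fun w => -μ c 2 w) (fun w => -μ c 3 w))).RP => letterOf (core.lam b) (core.hlam b) ((pinnedVacs core.kind (fun w => -μ c 2 w) (fun w => -μ c 3 w)) b) (core.kind b) (n b)) =
        fun b : (printPlaces (InfinitePlace (L : Type)) core.kind core.lam core.hlam (pinnedVacs core.kind (fun w => -μ c 2 w) (fun w => -μ c 3 w))).RP => (printLoc (core.lam b) (core.hlam b) ((pinnedVacs core.kind (fun w => -μ c 2 w) (fun w => -μ c 3 w)) b) (core.kind b)).φ :=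
      funext fun b => letterOf_eq_φ (core.lam b) (core.hlam b) ((pinnedVacs core.kind (fun w => -μ c 2 w) (fun w => -μ c 3 w)) b) (core.kind b) (n b) (hn b)
    rw [hfun]
    exact hbase χ f)

end Context34

end Gen12PinsP

end HodgeCM.Model

end
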